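import Summits.QuantumFields.QCD.Theses.NestedDissectionSea
import Literature.MathematicalPhysics.QuantumFieldTheory.SpectralDefectDensity

/-!
# Sketch (crux-ideate r1, ideator 3) — first lemmas of the two idea cards for
`NegativeCellsDilute` (stmt-QuantumFields-13900)

Card `count-the-flow`: `cellCrossCount`, `towerCrossCount`, `DefectLeCrossCount`,
`LeafDefectIffOdd`, `CrossingShift`, `FirstMomentCrosserLaw` (the transfer C⁺) and
`DiluteOfFirstMoment`.

Card `mirror-doubling`: `siteMirror`, `cellMirror`, `upperDouble`, `lowerDouble`,
`MirrorCellNonneg`, `MirrorChildPairing`, `MirrorDomination`.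

All are `def … : Prop` (statements, not proofs) over the landed `WilsonCellSchur` vocabulary.
-/

noncomputable section

namespace Summit.QuantumFields.QCD.Cruxes.NegativeCellsDilute.Ideator3

open Literature.MathematicalPhysics.QuantumLattice Literature.MathematicalPhysics.QuantumFieldTheory
  Literature.Probability.LatticeModels
open MeasureTheory

/-- Local notation: the colour group `SU(3)`. -/
local notation "𝔾" => Matrix.specialUnitaryGroup (Fin 3) ℂ

variable {N : ℕ} [NeZero N]

/-! ## Card 1 — count the flow -/

/-- **Early-crosser count of a Dirichlet cell at valence mass `μ`**: the number of REAL eigenvalues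
`≤ 0` of `wilsonCell U μ x s`, with algebraic multiplicity (`realSpecCount`, SpectralDefectDensity).
Since `wilsonCell U μ' x s = wilsonCell U μ x s + (μ' - μ)•1`, this is the number of bare masses
`μ' ≥ μ` (with multiplicity) at which the cell is singular — the number of real-eigenvalue
CROSSINGS AT OR ABOVE the valence mass. -/
def cellCrossCount (U : GaugeConfig 4 N 𝔾) (μ : ℝ) (x : TorusSite 4 N) (s : Fin 4 → ℕ) : ℕ :=
  realSpecCount (wilsonCell U μ x s) 0

/-- The tower count of the corner-`0` box of sides `s`: parent plus its sixteen children. -/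
def towerCrossCount (U : GaugeConfig 4 N 𝔾) (μ : ℝ) (s : Fin 4 → ℕ) : ℕ :=
  cellCrossCount U μ 0 s + ∑ ε : Fin 4 → Bool, cellCrossCount U μ (halfCorner s ε) (halfSides s ε)

/-- **First lemma of card 1 (deterministic, provable now).** A sign defect at any level forces at
least one crossing at or above the valence mass in the parent or a child:
`IsSignDefect U μ j s → 1 ≤ towerCrossCount U μ s`. (From `SignDefectForcesCrossing`: a zero of
`det (wilsonCell U μ' · ·)` at `μ' ≥ μ` is a real eigenvalue `μ - μ' ≤ 0` of the cell at mass `μ`,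
i.e. a root of its characteristic polynomial counted by `realSpecCount … 0`.) -/
def DefectLeCrossCount : Prop :=
  ∀ (N : ℕ) [NeZero N] (U : GaugeConfig 4 N 𝔾) (μ : ℝ) (j : ℕ) (s : Fin 4 → ℕ),
    IsSignDefect U μ j s → 1 ≤ towerCrossCount U μ s

/-- **Leaf parity identity (provable now, size M).** Off the determinant-zero set, the leaf cell is a
sign defect iff its early-crosser count is odd: the determinant is real (`DirichletDetReal`), the
non-real eigenvalues pair up by `γ₅`-hermiticity, so `sign det = (-1)^{#real eigenvalues < 0}`. -/
def LeafDefectIffOdd : Prop :=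
  ∀ (N : ℕ) [NeZero N] (U : GaugeConfig 4 N 𝔾) (μ : ℝ) (s : Fin 4 → ℕ),
    (wilsonCell U μ 0 s).det ≠ 0 → (cellDetRe U μ 0 s < 0 ↔ Odd (cellCrossCount U μ 0 s))

/-- **Crossing shift (exact, provable now).** A kernel vector of the cell at bare mass `x'` is an
eigenvector of the cell at bare mass `x` with eigenvalue `x - x'`; in particular a crossing within
`η` of `x` gives `σ_min (wilsonCell U x · ·) ≤ η` — the bridge from crossing counts to Wegner-type
(smallest-singular-value / zero-energy density-of-states) estimates of `Γ₅ · wilsonCell U x`. -/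
def CrossingShift : Prop :=
  ∀ (N : ℕ) [NeZero N] (U : GaugeConfig 4 N 𝔾) (x x' : ℝ) (y : TorusSite 4 N) (s : Fin 4 → ℕ)
    (w : {p // wilsonBox y s p} → ℂ),
    (wilsonCell U x' y s).mulVec w = 0 → (wilsonCell U x y s).mulVec w = ((x - x' : ℝ) : ℂ) • w

/-- **C⁺ = FIRST-MOMENT EARLY-CROSSER LAW** (the transfer of card 1; same `∃ reg … ∀ m ∃ R` prefix as
`NegativeCellsDilute`). Clause (a⁺): inside the physical window the phase-quenched EXPECTED NUMBER of
crossings at or above the valence masses in the tower {box, 16 children}, summed over flavours, is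
`≤ δ_j` with `0 ≤ δ_j`, `Σ_j δ_j ≤ ε`; clause (b) = the parity pin of `NegativeCellsDilute` verbatim.
By Markov and `DefectLeCrossCount` it implies `EarlyCrosserLaw` (a′) and `NegativeCellsDilute` (a). -/
def FirstMomentCrosserLaw : Prop :=
  ∀ Nf : ℕ, (Nf = 2 ∨ Nf = 3) → ∃ reg : QCDRegularisation Nf, reg.HasMassScaling ∧
    (reg.scheme 0 0 0).HasAsymptoticScaling ∧ ∃ M₀ : ℝ, 0 ≤ M₀ ∧ ∃ b₀ : ℕ, 2 ≤ b₀ ∧ ∃ ℓ : ℝ, 0 < ℓ ∧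
    ∀ m : Fin Nf → ℝ, (∀ f, M₀ < m f) → ∃ R : ℝ, 0 < R ∧
    (∀ ε : ℝ, 0 < ε → ∀ᶠ k : ℕ in Filter.atTop, ∀ S : ℕ, R ≤ reg.a k * (2 * S + 1) →
      let N : ℕ := 2 * S + 1
      let mq : Fin Nf → ℝ := fun f => reg.mcrit k + reg.a k * m f / reg.Zm k
      let wt : GaugeConfig 4 N (Matrix.specialUnitaryGroup (Fin 3) ℂ) → ℝ :=
        fun U => ∏ f, ‖fermionDet (wilsonDirac (fundamentalRep (Fin 3)) U (mq f) 1)‖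
      let E : (GaugeConfig 4 N (Matrix.specialUnitaryGroup (Fin 3) ℂ) → ℝ) → ℝ := fun F =>
        (∫ U, F U * wt U ∂(wilsonMeasure (d := 4) (L := N) (fundamentalRep (Fin 3)) (reg.β k))) /
          (∫ U, wt U ∂(wilsonMeasure (d := 4) (L := N) (fundamentalRep (Fin 3)) (reg.β k)))
      let J : ℕ := Nat.log 2 (⌊ℓ / reg.a k⌋₊ / b₀) + 1
      ∃ δ : ℕ → ℝ, (∀ j, 0 ≤ δ j) ∧ ∑ j ∈ Finset.range J, δ j ≤ ε ∧ ∀ j < J, ∀ s : Fin 4 → ℕ,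
        (∀ i, b₀ * 2 ^ j ≤ s i ∧ s i < b₀ * 2 ^ (j + 2) ∧ s i ≤ N ∧ (s i : ℝ) * reg.a k ≤ ℓ) →
          E (fun U => ∑ f, (towerCrossCount U (mq f) s : ℝ)) ≤ δ j) ∧
    (∀ M : ℝ, M₀ < M → ∀ᶠ k : ℕ in Filter.atTop, ∀ S : ℕ, R ≤ reg.a k * (2 * S + 1) →
      let N : ℕ := 2 * S + 1
      let mq : Fin Nf → ℝ := fun f => reg.mcrit k + reg.a k * m f / reg.Zm k
      let wt : GaugeConfig 4 N (Matrix.specialUnitaryGroup (Fin 3) ℂ) → ℝ :=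
        fun U => ∏ f, ‖fermionDet (wilsonDirac (fundamentalRep (Fin 3)) U (mq f) 1)‖
      (1 / 4 : ℝ) ≤
        (∫ U, (if (fermionDet (wilsonDirac (fundamentalRep (Fin 3)) U
              (reg.mcrit k - reg.a k * M / reg.Zm k) 1)).re < 0 then (1 : ℝ) else 0) * wt U
            ∂(wilsonMeasure (d := 4) (L := N) (fundamentalRep (Fin 3)) (reg.β k))) /
          (∫ U, wt U ∂(wilsonMeasure (d := 4) (L := N) (fundamentalRep (Fin 3)) (reg.β k))))

/-- The glue of card 1 (pure measure-theoretic logic once `DefectLeCrossCount` is in hand: the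
indicator of the defect event is pointwise `≤` the flavour-summed tower count, and both integrals
share the positive weight `wt`). -/
def DiluteOfFirstMoment : Prop :=
  FirstMomentCrosserLaw → Summit.QuantumFields.QCD.Theses.NestedDissectionSea.NegativeCellsDilute

/-! ## Card 2 — mirror doubling -/

/-- The SITE MIRROR of the corner-`0` box of sides `s` in direction `μ`: reflection of the `μ`-th
coordinate in the mid-sheet `{y_μ = s_μ / 2}` (a sheet of the dissection when `s_μ` is even):
`y_μ ↦ s_μ - y_μ`, other coordinates fixed. -/
def siteMirror (s : Fin 4 → ℕ) (μ : Fin 4) (y : TorusSite 4 N) : TorusSite 4 N :=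
  Function.update y μ ((s μ : ZMod N) - y μ)

/-- The induced mirror on gauge fields: links transverse to `μ` are carried along; the `μ`-link from
`y` to `y + e_μ` is sent to the REVERSED `μ`-link from `θ(y + e_μ) = θy - e_μ` to `θy`, whence the
inverse (same pattern as the tree's `GaugeConfig.negReflect`, with the mirror plane moved from
`t = 0` to `y_μ = s_μ/2`). -/
def cellMirror (U : GaugeConfig 4 N 𝔾) (s : Fin 4 → ℕ) (μ : Fin 4) : GaugeConfig 4 N 𝔾 :=
  fun e => if e.2 = μ then (U (siteMirror s μ (Literature.MathematicalPhysics.QuantumFieldTheory.Site.shift e.1 μ), μ))⁻¹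
    else U (siteMirror s μ e.1, e.2)

/-- The UPPER MIRROR DOUBLE of `U` across the `μ`-mid-sheet of the box: `U` itself on links starting
at `y_μ ≥ s_μ/2` (upper half-cell and the in-sheet links), the mirror image of that upper half below.
It is `cellMirror`-symmetric by construction. -/
def upperDouble (U : GaugeConfig 4 N 𝔾) (s : Fin 4 → ℕ) (μ : Fin 4) : GaugeConfig 4 N 𝔾 :=
  fun e => if s μ / 2 ≤ (e.1 μ).val then U e else cellMirror U s μ e

/-- The LOWER MIRROR DOUBLE: the lower half-cell of `U` and its mirror image above. -/
def lowerDouble (U : GaugeConfig 4 N 𝔾) (s : Fin 4 → ℕ) (μ : Fin 4) : GaugeConfig 4 N 𝔾 :=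
  upperDouble (cellMirror U s μ) s μ

/-- **First lemma of card 2 (reflection positivity at fixed background; provable from
Osterwalder–Seiler/Lüscher site-reflection positivity of `r = 1` Wilson fermions, hopping parameter
`K = 1/(2x+8) < 1/6`, i.e. bare mass `x > -1`).** If the side `s_μ` is even (so the `μ`-mid-sheet is a
site sheet of the dissection, exchanging the children pairwise) and the background is mirror
symmetric across it, then the Dirichlet cell determinant is `≥ 0` and the box is a sign defect at NO
level: the Grassmann integral on the cell is `⟨Θ(1)·1⟩ ≥ 0`, and the sixteen children pair up into
mirror images with equal determinants. -/
def MirrorCellNonneg : Prop :=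
  ∀ (N : ℕ) [NeZero N] (U : GaugeConfig 4 N 𝔾) (x : ℝ) (s : Fin 4 → ℕ) (μ : Fin 4),
    (∀ i, s i ≤ N) → Even (s μ) → -1 < x → cellMirror U s μ = U →
      0 ≤ cellDetRe U x 0 s ∧ ∀ j, ¬ IsSignDefect U x j s

/-- **Mirror covariance of children (linear algebra, provable now).** Reflecting the background
reflects the cell: the determinant of the child `ε` for the mirrored field equals the determinant of
the mirror child (`ε` with its `μ`-bit flipped) for the original field (conjugate the cell matrix by
the site permutation times the spin matrix `γ_μ γ₅`, which anticommutes with `γ_μ` and commutes with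
the other `γ_ν`). -/
def MirrorChildPairing : Prop :=
  ∀ (N : ℕ) [NeZero N] (U : GaugeConfig 4 N 𝔾) (x : ℝ) (s : Fin 4 → ℕ) (μ : Fin 4) (ε : Fin 4 → Bool),
    (∀ i, s i ≤ N) → Even (s μ) →
      cellDetRe (cellMirror U s μ) x (halfCorner s ε) (halfSides s ε) =
        cellDetRe U x (halfCorner s (Function.update ε μ (!ε μ))) (halfSides s (Function.update ε μ (!ε μ)))

/-- **Mirror domination (Cauchy–Schwarz for the reflection-positive kernel
`(V, W) ↦ det D_c[θV ∪ W]`; provable from the same RP).** The squared cell determinant is at most the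
product of the determinants of its two mirror doubles, each of which is `≥ 0` by `MirrorCellNonneg`;
equivalently `det D_c[U] = ⟨Ψ(θU₋), Ψ(U₊)⟩` is a Gram entry of the half-cell Osterwalder–Schrader
states, and a sign defect is an OBTUSE angle between them. -/
def MirrorDomination : Prop :=
  ∀ (N : ℕ) [NeZero N] (U : GaugeConfig 4 N 𝔾) (x : ℝ) (s : Fin 4 → ℕ) (μ : Fin 4),
    (∀ i, s i ≤ N) → Even (s μ) → -1 < x →
      cellDetRe U x 0 s ^ 2 ≤ cellDetRe (lowerDouble U s μ) x 0 s * cellDetRe (upperDouble U s μ) x 0 s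

end Summit.QuantumFields.QCD.Cruxes.NegativeCellsDilute.Ideator3

end
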